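/-
Copyright (c) 2026 the pub-hodgecm-mathlib formalisation cell (harness21).  Prover seat hodgecm-mathlib-R90-C10-p02 (g3), SLAB R90-TF, section S1 «Ch. 10∕12 local»
(base R90-C10); crux H413 = `stmt-HodgeConjecture-24833`; line (D-1) «B_pos at INERT places» of U4Keys :182 (S1 junction A2′), memo
`R90/R90-C10-p05/g2/DESIGN-Bpos-inert.md` f70d293d60bf8a4b; card (B-5z) «the `HE` discharge modulo the master» dealt BY NAME by R90-C10-plan (g2) 2026-09-05T00:35:59Z —
FILE C, the card itself.  KERNEL module: THEOREMS ONLY (no definition, no named fact, no `sorry`, no instance, no notation).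
-/
import Summits.HodgeConjecture.HodgeConjecture.Theorems.R90S1BposPairIntegrandIndicatorsTwoDepth   -- FILE B (this seat): the four indicator identities, `measurableSet_box`∕`_cutoff`, `measure_box_lt_top`; brings FILES A∕A′
import Summits.HodgeConjecture.HodgeConjecture.Theorems.R90S1BposCellCoverTwoDepthKZeroCM            -- ★ p863461 (B-2b″) (R90-C10-p08 (g2)): `cells_witness_kZero` (the letter `hwit` at `k = 0`)
import Summits.HodgeConjecture.HodgeConjecture.Theorems.R90S1BposMasterIntegral                     -- ★ p864299 (B-5) part 3b (R90-C10-p06 (g3), head by lead R90-C10-p05 (g2)): `setIntegral_cutoff_F₀_eq` — THE MASTER INTEGRAL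
import Summits.HodgeConjecture.HodgeConjecture.Theorems.R90S1BposBoxVolumesTwoDepth                  -- ★ p864058 (B-5v) (R90-C10-p05 (g2) line): `measureReal_box_eq` — the box volumes `μ{|x| ≤ eᵗ, |z| ≤ eᵉ} = q^{2t+e}·μ(N₀)`
import Summits.HodgeConjecture.HodgeConjecture.Theorems.K2E3BranchBShellScalingFromWeightSeries     -- ★ p862287 (K2E3-p06 (g5)): `integrableOn_F₀_S_ge` (`F₀` integrable on `{1 ≤ |z|}` for a contracting `χ₁`)
import Summits.HodgeConjecture.HodgeConjecture.Theorems.K2E3BranchBSkewUnitExists                     -- ★ (R90-C10-p04 (g0)): `exists_skew_unit_valued_eq_one`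
import Summits.HodgeConjecture.HodgeConjecture.Theorems.K2E3BranchBSkewUnitSign                       -- ★ p862070 (K2E3-p03 (g9)): `coe_apply_skew_unit_sq` (`χ₁(δ₀)² = 1`)
import Summits.HodgeConjecture.HodgeConjecture.Theorems.K2E3KeysThmTwoDepthZeroBranchBConstants       -- ★ (K2E3-p32 (g0)): `measureReal_setOf_mem_ne_zero` (`μ(N₀) ≠ 0`)
import HarnessLib

/-!
# R90-TF · S1 «Ch10-local» ∕ K2 E3 «U4Keys» :182, BRANCH B AT POSITIVE DEPTH (all inert places) — brick (B-5z) `R90S1BposPairEntriesOfMaster`: THE LETTER `HE` OF THE LEAF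
# ★ p863671 `R90S1KeysThmTwoPosDepthBranchBInertAllLeaf` §2 DISCHARGED MODULO THE MASTER INTEGRAL AND A BOX VOLUME — for every frame and every normalised `(J_e, θ)`-type basis
# `(f₁, f_w)` the four Casselman-pair entries are integrable and take ★ (B-6)'s closed forms with `V = μ(N₀)`, `ε₀ = χ₁(δ₀)`, `c₂ = (−1)^m`
# [Casselman1980 §3; Casselman1995 §6.4, Thm. 6.6.2; Roche1998 §3–§4; Keys1984 §3, §7 Thm (2); Rogawski1990 §12.2]

Cell `pub/hodgecm-mathlib`, crux H413 = `stmt-HodgeConjecture-24833`, route of record `HCCMUnconditional` (no route verbs); R90-TF section S1 (junction socket A2′ = U4Keys :217, REL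
over :155 and :182).  THEOREMS ONLY; lane `--supports stmt-HodgeConjecture-24833 --as helper`, count-neutral.  NOT THE PAYER of :182 by itself: its CONCLUSION is the body of the letter `HE`
of ★ p863671 `R90S1KeysThmTwoPosDepthBranchBInertAllLeaf` §2 with `HE`'s binders in the same order and NO further letter — the master integral is ★ p864299
`R90.S1.BposMasterIntegral.setIntegral_cutoff_F₀_eq` (lead R90-C10-p05 (g2), pen R90-C10-p06 (g3)) and the box volumes are ★ p864058 `R90.S1.BposBoxVolumesTwoDepth.measureReal_box_eq` — so the
(B-7⁺) head of record is ONE application: `exists_eta_of_reducible_posDepth_normTrivial_inertAll_of_pairEntries … (pairEntries_of_master L v hns hunr χ₁ h₁ hcontr hB) hred` (head pen: p05).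
THE POINT (memo §3–§4).  On the `(J_e, θ)`-plane: `Λ_1 f_w = μ{n ∈ J_e} = μ B(r₁,0) = q^{−2r₁}V` (M12), `Λ_{w₀} f₁ = μ{w₀nw₀ ∈ J_e} = μ B(r₂,1) = q^{−2r₂−1}V` (M21), `Λ_{w₀} f_w = ∫_{C(r₁,0)} F₀
= MASTER(r₁, 0)` (M22), `Λ_1 f₁ = ∫_{C(r₂,1)} F₀ = MASTER(r₂, 1)` (M11) — FILE B's indicators integrated (`integral_indicator(_const)`, FILE B measurability), the integrability letters from ★
`integrableOn_F₀_S_ge` (`C ⊆ {1 ≤ |z|}`) and `measure_box_lt_top`; `V = μ(N₀) ≠ 0` ★ `measureReal_setOf_mem_ne_zero` through ★ `setOf_v_le_one_eq_setOf_mem`; `ε₀ = χ₁(δ₀)` for a skew unit `δ₀` (★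
`exists_skew_unit_valued_eq_one`, `ε₀² = 1` ★ `coe_apply_skew_unit_sq`); `c₂ := (−1)^m` reconciles the master's `(−1)^{m+1}(−X)^{j₀}` with ★ (B-6)'s shapes at `j₀ ∈ {0, 1}` (`hρ`: `2r₁ ≤ m+1`,
`2r₂ ≤ m+2` from `r₁ + r₂ = m + 1`, `r₁ ≤ r₂ ≤ r₁ + 1`); the box volumes ★ at `(t, e) = (−r₁, 0), (−r₂, −1)` read on `B(r₁,0)`, `B(r₂,1)` by `|ϖ|ᵏ = exp(−k)`; the witness letter `hwit` of FILE B
is ★ (B-2b″) `cells_witness_kZero`.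
* **`pairEntries_of_master`** — the letter `HE`, letter-free.
HONEST LABEL.  HC_CM is proved only modulo the 7 printed citations (2 remaining named inputs: hLiu418 = `stmt-HodgeConjecture-24832`, h413 = `stmt-HodgeConjecture-24833`) until rung 0
closes; count-neutral — this file is the LAST HELPER under the (B-7⁺) head, which p05 appends; :182 ∕ A2′ OPEN until then and until K2E3 ties (S-I); REL ≠ ★ ≠ BUILT.

## References
* [Casselman1980] W. Casselman, *The unramified principal series of p-adic groups I*, Compositio Math. 40 (1980), §3.
* [Casselman1995] W. Casselman, *Introduction to the theory of admissible representations of `p`-adic reductive groups* (1995), §6.4, Thm. 6.6.2.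
* [Roche1998] A. Roche, *Types and Hecke algebras for principal series representations of split reductive p-adic groups*, Ann. Sci. ÉNS (4) 31 (1998), §3–§4.
* [Keys1984] D. Keys, *Principal series representations of special unitary groups over local fields*, Compositio Math. 51 (1984), §3, §7 Theorem (2) p. 126.
* [Rogawski1990] J. D. Rogawski, *Automorphic Representations of Unitary Groups in Three Variables*, Ann. of Math. Stud. 123 (1990), §12.1 p. 171, §12.2 (1)–(2) p. 173.
-/

set_option autoImplicit false
-- the mandated namespace has the single-problem summit's repeated segment (`HodgeConjecture.HodgeConjecture`)
set_option linter.dupNamespace false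

noncomputable section

open NumberField IsDedekindDomain MeasureTheory
open scoped Matrix MatrixGroups WithZero Valued NNReal
open Literature.NumberTheory Literature.NumberTheory.Automorphic Literature.NumberTheory.Automorphic.UnitaryGroup
open Literature.NumberTheory.Rogawski1990

namespace Summit.HodgeConjecture.HodgeConjecture.R90.S1.BposPairEntriesOfMaster

open Summit.HodgeConjecture.HodgeConjecture.Cruxes.H413
open Summit.HodgeConjecture.HodgeConjecture.Cruxes.H413.K2E3DepthZeroIwahoriCharacterCM
open Summit.HodgeConjecture.HodgeConjecture.R90.S1
open Summit.HodgeConjecture.HodgeConjecture.R90.S1.BposPairIntegrandsTwoDepth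

variable (L : Type) [Field L] [NumberField L] [IsCMField L] (v : HeightOneSpectrum (𝓞 ↥(maximalRealSubfield L)))

/-! ## The letter `HE` from the master integral and the box volume -/

open Classical in
set_option maxHeartbeats 4000000 in
set_option synthInstance.maxHeartbeats 400000 in
-- two carriers of `U(Φ₃)(L⁺_v)`, slow unification (class of FILE B ∕ ★ `K2E3KeysThmTwoDepthZeroBranchBConstants`)
/-- **THE LETTER `HE` OF ★ `R90S1KeysThmTwoPosDepthBranchBInertAllLeaf` §2, DISCHARGED.**  `v` non-split (`hns`) and UNRAMIFIED in `L` (`hunr`); `χ₁ : (L ⊗ L⁺_v)ˣ → ℂˣ` continuous (`h₁`),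
contracting (`hcontr`), with `χ₁(u·σu) = 1` on the units of valuation one (`hB`, Branch B).  Then, for every (G3) frame `(w, eA, ϖ, g₁, K₀, K₁, I)`, every conductor datum `(m ≥ 1, hcond at |ϖ|^{m+1},
exact witness u₁)`, every aligned pair `r₁ + r₂ = m + 1`, `r₁ ≤ r₂ ≤ r₁ + 1` with Roche's group `Je = eA⁻¹(Jg)`, `e = (r₁, 0; r₂, 1)`, every `w₀` of matrix `Φ₃`, every Borel Haar measure `μ` on `N(L⁺_v)`
and every NORMALISED `(J_e, θ)`-type basis `(f₁, f_w)` of `i(χ₁, 1)`: the four cell integrals `∫_N f(w₀ n g) dμ` are integrable and **`Λ_1 f₁ = c₂·(ε₀·((q−1)∕q^{m+2})·V·X∕(1+X))`,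
`Λ_{w₀} f_w = −c₂·(ε₀·((q−1)∕q^{m+2})·V∕(1+X))`, `Λ_1 f_w = (q^{2r₁})⁻¹·V`, `Λ_{w₀} f₁ = (q^{2r₂+1})⁻¹·V`** (`X = χ₁(ϖ̂)`, `q = N𝔭_v`) with `V = μ{|z|_w ≤ 1} ≠ 0`, `ε₀ = χ₁(δ₀)` (`ε₀² = 1`),
`c₂ = (−1)^m` — EXACTLY the body of `HE` (bytes transplanted), so `HE := pairEntries_of_master L v hns hunr χ₁ h₁ hcontr hB`.  Proof: FILE B's four indicator identities (witness letter ★ (B-2b″)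
`cells_witness_kZero`), `integral_indicator` ∕ `integral_indicator_const`, ★ MASTER `setIntegral_cutoff_F₀_eq` at `(ρ, j₀) = (r₁, 0)` (`hwwv`) and `(r₂, 1)` (`h11v`), ★ `measureReal_box_eq` at
`(−r₁, 0)` (`hw1v`) and `(−r₂, −1)` (`h1wv`), ★ `integrableOn_F₀_S_ge`, FILE B `measure_box_lt_top`, ★ `measureReal_setOf_mem_ne_zero`, `ring`. [cite: Casselman1980, §3]
[cite: Casselman1995, §6.4, Thm. 6.6.2] [cite: Roche1998, §3–§4] [cite: Keys1984, §3, §7 Theorem (2) p. 126] [cite: Rogawski1990, §12.2 (1)–(2) p. 173] -/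
theorem pairEntries_of_master
    (hns : ∀ w' : PlacesOver L v, IsCMField.complexConj L • w'.1 = w'.1) (hunr : Algebra.IsUnramifiedIn (𝓞 L) v.asIdeal)
    (χ₁ : (LocalRing L v)ˣ →* ℂˣ) (h₁ : Continuous fun x => ((χ₁ x : ℂˣ) : ℂ))
    (hcontr : ∀ x : (LocalRing L v)ˣ, unitModulusChar (LocalRing L v) x < 1 → ‖((χ₁ x : ℂˣ) : ℂ)‖ < 1)
    (hB : ∀ u : (LocalRing L v)ˣ, (∀ w' : PlacesOver L v, Valued.v ((u : LocalRing L v) w') = 1) →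
      χ₁ (u * Units.map (conjLocal L (IsCMField.complexConj L) v : LocalRing L v →* LocalRing L v) u) = 1)
    (w : PlacesOver L v) (hw : IsCMField.complexConj L • w.1 = w.1)
    (eA : Gqs L v ≃ₜ* ↥(unitaryGroupOfForm (galAdicCompletionMap (L := L) (IsCMField.complexConj L) hw) ((StdForm.antidiagonal 3).over (w.1.adicCompletion L))))
    (heA : ∀ g : Gqs L v,
        ((eA g : ↥(unitaryGroupOfForm (galAdicCompletionMap (L := L) (IsCMField.complexConj L) hw) ((StdForm.antidiagonal 3).over (w.1.adicCompletion L)))) :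
            GL (Fin 3) (w.1.adicCompletion L)) =
          ((localNonsplitEquiv (IsCMField.complexConj L) (qsForm L) (IsCMField.complexConj_ne_one L) w hw g :
            ↥(unitaryGroupOfForm (galAdicCompletionMap (L := L) (IsCMField.complexConj L) hw) (placeForm (qsForm L) w.1))) : GL (Fin 3) (w.1.adicCompletion L)))
    (ϖ : w.1.adicCompletion L) (hϖ : Valued.v ϖ = WithZero.exp (-1 : ℤ))
    (g₁ : GL (Fin 3) (w.1.adicCompletion L)) (hg₁ : (g₁ : Matrix (Fin 3) (Fin 3) (w.1.adicCompletion L)) = Matrix.diagonal ![(1 : w.1.adicCompletion L), 1, ϖ])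
    (K0 K1 I : Subgroup (Gqs L v))
    (hK0 : K0 = ((glInt 3 (w.1.adicCompletion L)).subgroupOf
        (unitaryGroupOfForm (galAdicCompletionMap (L := L) (IsCMField.complexConj L) hw) ((StdForm.antidiagonal 3).over (w.1.adicCompletion L)))).comap
          eA.toMulEquiv.toMonoidHom)
    (hK1 : K1 = (((glInt 3 (w.1.adicCompletion L)).map (MulAut.conj g₁).toMonoidHom).subgroupOf
        (unitaryGroupOfForm (galAdicCompletionMap (L := L) (IsCMField.complexConj L) hw) ((StdForm.antidiagonal 3).over (w.1.adicCompletion L)))).comap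
          eA.toMulEquiv.toMonoidHom)
    (hI : I = K0 ⊓ K1)
    (m : ℕ) (hm : 1 ≤ m)
    (hcond : ∀ u : (LocalRing L v)ˣ, (∀ w' : PlacesOver L v, Valued.v (((u : LocalRing L v) w') - 1) ≤ Valued.v ϖ ^ (m + 1)) → χ₁ u = 1)
    (u₁ : (LocalRing L v)ˣ) (hu₁ : ∀ w' : PlacesOver L v, Valued.v (((u₁ : LocalRing L v) w') - 1) ≤ Valued.v ϖ ^ m) (hχu₁ : χ₁ u₁ ≠ 1)
    (r₁ r₂ : ℕ) (hrr : r₁ + r₂ = m + 1) (hr12 : r₁ ≤ r₂) (hr21 : r₂ ≤ r₁ + 1)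
    (Jg : Subgroup ↥(unitaryGroupOfForm (galAdicCompletionMap (L := L) (IsCMField.complexConj L) hw) ((StdForm.antidiagonal 3).over (w.1.adicCompletion L))))
    (hJg : ∀ k : ↥(unitaryGroupOfForm (galAdicCompletionMap (L := L) (IsCMField.complexConj L) hw) ((StdForm.antidiagonal 3).over (w.1.adicCompletion L))),
        k ∈ Jg ↔ ∀ i j, Valued.v (((k : GL (Fin 3) (w.1.adicCompletion L)) : Matrix (Fin 3) (Fin 3) (w.1.adicCompletion L)) i j) ≤
          Valued.v ϖ ^ (![![0, r₁, 0], ![r₂, 0, r₁], ![1, r₂, 0]] : Fin 3 → Fin 3 → ℕ) i j)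
    (Je : Subgroup (Gqs L v)) (hJe : Je = Jg.comap eA.toMulEquiv.toMonoidHom)
    (w₀ : ↥(unitaryGroupOfForm (conjLocal L (IsCMField.complexConj L) v) (cmLocalForm L 3 v))) (hw₀ : Units.val (w₀ : GL (Fin 3) (LocalRing L v)) = cmLocalForm L 3 v)
    [MeasurableSpace ↥(cmBorelTriple L 3 v).N] [BorelSpace ↥(cmBorelTriple L 3 v).N] (μ : Measure ↥(cmBorelTriple L 3 v).N) [μ.IsHaarMeasure]
    (f₁ f_w : haveI := locallyCompactSpace_cmBorelU L 3 v
        Representation.SmoothInd (cmBorelTriple L 3 v).P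
          (Representation.twist (((Representation.trivial ℂ ↥(torusU (conjLocal L (IsCMField.complexConj L) v) (cmLocalForm L 3 v)) ℂ).twist
            (cmTorusCharPair L v χ₁ 1)).comp (cmBorelTriple L 3 v).proj) (rootDeltaChar (cmBorelTriple L 3 v).P)))
    (heig₁ : ∀ x ∈ Je, (haveI := locallyCompactSpace_cmBorelU L 3 v; Representation.smoothIndRep _ _ x f₁) =
    (if h : IsUnit (((x.val : GL (Fin 3) (LocalRing L v)) : Matrix (Fin 3) (Fin 3) (LocalRing L v)) 0 0) then ((χ₁ h.unit : ℂˣ) : ℂ) else 0) • f₁)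
    (heig_w : ∀ x ∈ Je, (haveI := locallyCompactSpace_cmBorelU L 3 v; Representation.smoothIndRep _ _ x f_w) =
    (if h : IsUnit (((x.val : GL (Fin 3) (LocalRing L v)) : Matrix (Fin 3) (Fin 3) (LocalRing L v)) 0 0) then ((χ₁ h.unit : ℂˣ) : ℂ) else 0) • f_w)
    (h11 : f₁.toFun 1 = 1) (h1g : f₁.toFun w₀ = 0) (hw1 : f_w.toFun 1 = 0) (hwg : f_w.toFun w₀ = 1) :
    ∃ V ε₀ c₂ : ℂ, V ≠ 0 ∧ ε₀ ^ 2 = 1 ∧ c₂ ^ 2 = 1 ∧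
        Integrable (fun n : ↥(cmBorelTriple L 3 v).N => f₁.toFun (w₀ * (n : ↥(unitaryGroupOfForm (conjLocal L (IsCMField.complexConj L) v) (cmLocalForm L 3 v))) * 1)) μ ∧
        Integrable (fun n : ↥(cmBorelTriple L 3 v).N => f_w.toFun (w₀ * (n : ↥(unitaryGroupOfForm (conjLocal L (IsCMField.complexConj L) v) (cmLocalForm L 3 v))) * 1)) μ ∧
        Integrable (fun n : ↥(cmBorelTriple L 3 v).N => f₁.toFun (w₀ * (n : ↥(unitaryGroupOfForm (conjLocal L (IsCMField.complexConj L) v) (cmLocalForm L 3 v))) * w₀)) μ ∧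
        Integrable (fun n : ↥(cmBorelTriple L 3 v).N => f_w.toFun (w₀ * (n : ↥(unitaryGroupOfForm (conjLocal L (IsCMField.complexConj L) v) (cmLocalForm L 3 v))) * w₀)) μ ∧
        (∫ n : ↥(cmBorelTriple L 3 v).N, f₁.toFun (w₀ * (n : ↥(unitaryGroupOfForm (conjLocal L (IsCMField.complexConj L) v) (cmLocalForm L 3 v))) * 1) ∂μ =
          c₂ * (ε₀ * ((((Ideal.absNorm v.asIdeal : ℝ) : ℂ) - 1) / ((Ideal.absNorm v.asIdeal : ℝ) : ℂ) ^ (m + 1 + 1)) * V *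
            ((χ₁ (isUnit_toLocalRing_uniformizer L v).unit : ℂˣ) : ℂ) / (1 + ((χ₁ (isUnit_toLocalRing_uniformizer L v).unit : ℂˣ) : ℂ)))) ∧
        (∫ n : ↥(cmBorelTriple L 3 v).N, f_w.toFun (w₀ * (n : ↥(unitaryGroupOfForm (conjLocal L (IsCMField.complexConj L) v) (cmLocalForm L 3 v))) * w₀) ∂μ =
          -(c₂ * (ε₀ * ((((Ideal.absNorm v.asIdeal : ℝ) : ℂ) - 1) / ((Ideal.absNorm v.asIdeal : ℝ) : ℂ) ^ (m + 1 + 1)) * V /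
            (1 + ((χ₁ (isUnit_toLocalRing_uniformizer L v).unit : ℂˣ) : ℂ))))) ∧
        (∫ n : ↥(cmBorelTriple L 3 v).N, f_w.toFun (w₀ * (n : ↥(unitaryGroupOfForm (conjLocal L (IsCMField.complexConj L) v) (cmLocalForm L 3 v))) * 1) ∂μ =
          (((Ideal.absNorm v.asIdeal : ℝ) : ℂ) ^ (2 * r₁))⁻¹ * V) ∧
        (∫ n : ↥(cmBorelTriple L 3 v).N, f₁.toFun (w₀ * (n : ↥(unitaryGroupOfForm (conjLocal L (IsCMField.complexConj L) v) (cmLocalForm L 3 v))) * w₀) ∂μ =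
          (((Ideal.absNorm v.asIdeal : ℝ) : ℂ) ^ (2 * r₂ + 1))⁻¹ * V)
 := by
  haveI := locallyCompactSpace_cmBorelU L 3 v
  -- the sign `ε₀ = χ₁(δ₀)` of a skew unit, `ε₀² = 1`
  obtain ⟨δ₀, hδσ, hδv⟩ := K2E3BranchBSkewUnitExists.exists_skew_unit_valued_eq_one L v w hunr
  have hε : (((χ₁ δ₀ : ℂˣ) : ℂ)) ^ 2 = 1 := K2E3BranchBSkewUnitSign.coe_apply_skew_unit_sq L v w hw hunr χ₁ hB δ₀ hδσ hδv
  -- the shell family `R` of ★ (B-2b″) and its witness letter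
  obtain ⟨R, hR⟩ : ∃ R : Set ↥(unitaryGroupOfForm (conjLocal L (IsCMField.complexConj L) v) (cmLocalForm L 3 v)), ∀ r, r ∈ R ↔
      r ∈ ((cmBorelTriple L 3 v).N).map (MulAut.conj w₀).toMonoidHom ∧ r ∉ Je ∧
        ¬ (Valued.v ((((eA r : ↥(unitaryGroupOfForm (galAdicCompletionMap (L := L) (IsCMField.complexConj L) hw) ((StdForm.antidiagonal 3).over (w.1.adicCompletion L)))) : GL (Fin 3) (w.1.adicCompletion L)) : Matrix (Fin 3) (Fin 3) (w.1.adicCompletion L)) 2 1 / (((eA r : ↥(unitaryGroupOfForm (galAdicCompletionMap (L := L) (IsCMField.complexConj L) hw) ((StdForm.antidiagonal 3).over (w.1.adicCompletion L)))) : GL (Fin 3) (w.1.adicCompletion L)) : Matrix (Fin 3) (Fin 3) (w.1.adicCompletion L)) 2 0) ≤ Valued.v ϖ ^ r₁ ∧ (Valued.v ϖ ^ 0)⁻¹ ≤ Valued.v ((((eA r : ↥(unitaryGroupOfForm (galAdicCompletionMap (L := L) (IsCMField.complexConj L) hw) ((StdForm.antidiagonal 3).over (w.1.adicCompletion L))))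 : GL (Fin 3) (w.1.adicCompletion L)) : Matrix (Fin 3) (Fin 3) (w.1.adicCompletion L)) 2 0)) :=
    ⟨{r | _}, fun _ => Iff.rfl⟩
  have hwit := BposCellCoverTwoDepthKZeroCM.cells_witness_kZero L v w hw eA heA hϖ r₁ r₂ Jg hJg Je hJe w₀ hw₀ R hR hm hrr hr12 hr21 hunr χ₁ hcontr hcond u₁ hu₁ hχu₁
  -- the four integrands as indicators (FILE B), as functions on `N(L⁺_v)`
  have hfw1 : (fun n : ↥(cmBorelTriple L 3 v).N => f_w.toFun (w₀ * (n : ↥(unitaryGroupOfForm (conjLocal L (IsCMField.complexConj L) v) (cmLocalForm L 3 v))) * 1)) = Set.indicator {m : ↥(cmBorelTriple L 3 v).N | Valued.v (((((m : ↥(unitaryGroupOfForm (conjLocal L (IsCMField.complexConj L) v) (cmLocalForm L 3 v))) : GL (Fin 3) (LocalRing L v)) : Matrix (Fin 3) (Fin 3) (LocalRing L v)) 0 2) w) ≤ Valued.v ϖ ^ 0 ∧ Valued.v (((((m : ↥(unitaryGroupOfForm (conjLocal L (IsCMField.complexConj L) v) (cmLocalForm L 3 v))) : GL (Fin 3) (LocalRing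 L v)) : Matrix (Fin 3) (Fin 3) (LocalRing L v)) 0 1) w) ≤ Valued.v ϖ ^ r₁} (fun _ => (1 : ℂ)) := by
    funext n; rw [mul_one]
    exact toFun_weyl_mul_eq_indicator_box L v w hw eA heA r₁ r₂ Jg hJg Je hJe w₀ hw₀ χ₁ f_w heig_w R hR hwit hw1 hwg n
  have hf1w : (fun n : ↥(cmBorelTriple L 3 v).N => f₁.toFun (w₀ * (n : ↥(unitaryGroupOfForm (conjLocal L (IsCMField.complexConj L) v) (cmLocalForm L 3 v))) * w₀)) = Set.indicator {m : ↥(cmBorelTriple L 3 v).N | Valued.v (((((m : ↥(unitaryGroupOfForm (conjLocal L (IsCMField.complexConj L) v) (cmLocalForm L 3 v))) : GL (Fin 3) (LocalRing L v)) : Matrix (Fin 3) (Fin 3) (LocalRing L v)) 0 2) w) ≤ Valued.v ϖ ^ 1 ∧ Valued.v (((((m : ↥(unitaryGroupOfForm (conjLocal L (IsCMField.complexConj L) v) (cmLocalForm L 3 v))) : GL (Fin 3) (LocalRing L v)) : Matrix (Fin 3) (Fin 3) (LocalRing L v)) 0 1) w) ≤ Valued.v ϖ ^ r₂} (fun _ =>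 (1 : ℂ)) := by
    funext n
    exact toFun_conj_weyl_eq_indicator_box L v w hw eA heA hϖ r₁ r₂ Jg hJg Je hJe w₀ hw₀ χ₁ f₁ heig₁ R hR hwit h11 h1g n
  have hfww : (fun n : ↥(cmBorelTriple L 3 v).N => f_w.toFun (w₀ * (n : ↥(unitaryGroupOfForm (conjLocal L (IsCMField.complexConj L) v) (cmLocalForm L 3 v))) * w₀)) = Set.indicator {n : ↥(cmBorelTriple L 3 v).N | WithZero.exp (0 : ℤ) ≤ Valued.v (((((n : ↥(unitaryGroupOfForm (conjLocal L (IsCMField.complexConj L) v) (cmLocalForm L 3 v))) : GL (Fin 3) (LocalRing L v)) : Matrix (Fin 3) (Fin 3) (LocalRing L v)) 0 2) w) ∧ Valued.v (((((n : ↥(unitaryGroupOfForm (conjLocal L (IsCMField.complexConj L) v) (cmLocalForm L 3 v))) : GL (Fin 3) (LocalRing L v)) : Matrix (Fin 3) (Fin 3) (LocalRing L v)) 0 1) w) ≤ Valued.v ϖ ^ r₁ * Valued.v (((((n : ↥(unitaryGroupOfForm (conjLocal L (IsCMField.complexConj L) v) (cmLocalForm L 3 v))) : GL (Fin 3) (LocalRing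 L v)) : Matrix (Fin 3) (Fin 3) (LocalRing L v)) 0 2) w)}
      (fun n : ↥(cmBorelTriple L 3 v).N =>
        if h : IsUnit ((((n : ↥(unitaryGroupOfForm (conjLocal L (IsCMField.complexConj L) v) (cmLocalForm L 3 v))) : GL (Fin 3) (LocalRing L v)) : Matrix (Fin 3) (Fin 3) (LocalRing L v)) 0 2) then
          ((((χ₁ (Units.map ((conjLocal L (IsCMField.complexConj L) v) : LocalRing L v →* LocalRing L v) h.unit))⁻¹ : ℂˣ) : ℂ) *
            ((((unitModulusChar (LocalRing L v) h.unit)⁻¹ : ℝ≥0) : ℝ) : ℂ))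
        else 0) := by
    funext n
    exact toFun_conj_weyl_eq_indicator_cutoff L v w hw eA heA r₁ r₂ Jg hJg Je hJe w₀ hw₀ χ₁ f_w heig_w R hR hwit hw1 hwg n
  have hf11 : (fun n : ↥(cmBorelTriple L 3 v).N => f₁.toFun (w₀ * (n : ↥(unitaryGroupOfForm (conjLocal L (IsCMField.complexConj L) v) (cmLocalForm L 3 v))) * 1)) = Set.indicator {n : ↥(cmBorelTriple L 3 v).N | WithZero.exp (1 : ℤ) ≤ Valued.v (((((n : ↥(unitaryGroupOfForm (conjLocal L (IsCMField.complexConj L) v) (cmLocalForm L 3 v))) : GL (Fin 3) (LocalRing L v)) : Matrix (Fin 3) (Fin 3) (LocalRing L v)) 0 2) w) ∧ Valued.v (((((n : ↥(unitaryGroupOfForm (conjLocal L (IsCMField.complexConj L) v) (cmLocalForm L 3 v))) : GL (Fin 3) (LocalRing L v)) : Matrix (Fin 3) (Fin 3) (LocalRing L v)) 0 1) w) ≤ Valued.v ϖ ^ r₂ * Valued.v (((((n : ↥(unitaryGroupOfForm (conjLocal L (IsCMField.complexConj L) v) (cmLocalForm L 3 v))) : GL (Fin 3) (LocalRing L v))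 : Matrix (Fin 3) (Fin 3) (LocalRing L v)) 0 2) w)}
      (fun n : ↥(cmBorelTriple L 3 v).N =>
        if h : IsUnit ((((n : ↥(unitaryGroupOfForm (conjLocal L (IsCMField.complexConj L) v) (cmLocalForm L 3 v))) : GL (Fin 3) (LocalRing L v)) : Matrix (Fin 3) (Fin 3) (LocalRing L v)) 0 2) then
          ((((χ₁ (Units.map ((conjLocal L (IsCMField.complexConj L) v) : LocalRing L v →* LocalRing L v) h.unit))⁻¹ : ℂˣ) : ℂ) *
            ((((unitModulusChar (LocalRing L v) h.unit)⁻¹ : ℝ≥0) : ℝ) : ℂ))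
        else 0) := by
    funext n; rw [mul_one]
    exact toFun_weyl_mul_eq_indicator_cutoff L v w hw eA heA hϖ r₁ r₂ Jg hJg Je hJe w₀ hw₀ χ₁ f₁ heig₁ R hR hwit h11 h1g n
  -- measurability, finite mass, integrability of `F₀` on the two cut-off regions
  have hSb0 := BposPairIntegrandsTwoDepth.measurableSet_box L v w hw hϖ hunr r₁ 0
  have hSb1 := BposPairIntegrandsTwoDepth.measurableSet_box L v w hw hϖ hunr r₂ 1
  have hSc0 := BposPairIntegrandsTwoDepth.measurableSet_cutoff L v w hw hϖ hunr r₁ 0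
  have hSc1 := BposPairIntegrandsTwoDepth.measurableSet_cutoff L v w hw hϖ hunr r₂ 1
  have hfin0 := measure_box_lt_top L v w hw eA heA hϖ g₁ hg₁ K0 K1 I hK0 hK1 hI μ r₁ 0
  have hfin1 := measure_box_lt_top L v w hw eA heA hϖ g₁ hg₁ K0 K1 I hK0 hK1 hI μ r₂ 1
  have hint := K2E3BranchBShellScalingFromWeightSeries.integrableOn_F₀_S_ge L v w hw hns χ₁ h₁ hcontr μ
  have hint0 := hint.mono_set (cutoff_subset_setOf_one_le_v L v w (ϖ := ϖ) r₁ (le_refl (0 : ℤ)))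
  have hint1 := hint.mono_set (cutoff_subset_setOf_one_le_v L v w (ϖ := ϖ) r₂ (zero_le_one' ℤ))
  -- `V = μ(N₀) ≠ 0`
  have hV : ((μ.real {m : ↥(cmBorelTriple L 3 v).N | Valued.v (((((m : ↥(unitaryGroupOfForm (conjLocal L (IsCMField.complexConj L) v) (cmLocalForm L 3 v))) : GL (Fin 3) (LocalRing L v)) : Matrix (Fin 3) (Fin 3) (LocalRing L v)) 0 2) w) ≤ 1} : ℝ) : ℂ) ≠ 0 := by
    rw [K2E3BranchBCasselmanPairEntries.setOf_v_le_one_eq_setOf_mem L v w hw eA heA hϖ g₁ hg₁ K0 K1 I hK0 hK1 hI]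
    exact K2E3KeysThmTwoDepthZeroBranchBConstants.measureReal_setOf_mem_ne_zero L v w hw eA g₁ K0 K1 I hK0 hK1 hI μ
  -- the master at `(r₁, 0)` and `(r₂, 1)`, the boxes at `(r₁, 0)` and `(r₂, 1)`
  have hM0 := BposMasterIntegral.setIntegral_cutoff_F₀_eq L v w hw hns hunr χ₁ h₁ hcontr hB δ₀ hδσ hδv hϖ hm hcond u₁ hu₁ hχu₁ μ r₁ 0 (by omega)
  have hM1 := BposMasterIntegral.setIntegral_cutoff_F₀_eq L v w hw hns hunr χ₁ h₁ hcontr hB δ₀ hδσ hδv hϖ hm hcond u₁ hu₁ hχu₁ μ r₂ 1 (by omega)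
  simp only [Nat.cast_zero, pow_zero, mul_one] at hM0
  simp only [Nat.cast_one, pow_one] at hM1
  -- ★ (B-5v): the two box volumes, read on the boxes `B(r₁, 0)`, `B(r₂, 1)` (`|ϖ|ᵏ = exp(−k)`)
  have hpow : ∀ k : ℕ, Valued.v ϖ ^ k = WithZero.exp (-(k : ℤ)) := fun k => by rw [hϖ, ← WithZero.exp_nsmul]; simp
  have hB0 : μ.real {m : ↥(cmBorelTriple L 3 v).N | Valued.v (((((m : ↥(unitaryGroupOfForm (conjLocal L (IsCMField.complexConj L) v) (cmLocalForm L 3 v))) : GL (Fin 3) (LocalRing L v)) : Matrix (Fin 3) (Fin 3) (LocalRing L v)) 0 2) w) ≤ Valued.v ϖ ^ 0 ∧ Valued.v (((((m : ↥(unitaryGroupOfForm (conjLocal L (IsCMField.complexConj L) v) (cmLocalForm L 3 v))) : GL (Fin 3) (LocalRing L v)) : Matrix (Fin 3) (Fin 3) (LocalRing L v)) 0 1) w) ≤ Valued.v ϖ ^ r₁} =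
      ((Ideal.absNorm v.asIdeal : ℝ) ^ (2 * r₁))⁻¹ * μ.real {m : ↥(cmBorelTriple L 3 v).N | Valued.v (((((m : ↥(unitaryGroupOfForm (conjLocal L (IsCMField.complexConj L) v) (cmLocalForm L 3 v))) : GL (Fin 3) (LocalRing L v)) : Matrix (Fin 3) (Fin 3) (LocalRing L v)) 0 2) w) ≤ 1} := by
    have h := BposBoxVolumesTwoDepth.measureReal_box_eq L v w hw hunr μ (-(r₁ : ℤ)) 0 (by omega) (Or.inl rfl)
    have hset : {m : ↥(cmBorelTriple L 3 v).N | Valued.v (((((m : ↥(unitaryGroupOfForm (conjLocal L (IsCMField.complexConj L) v) (cmLocalForm L 3 v))) : GL (Fin 3) (LocalRing L v)) : Matrix (Fin 3) (Fin 3) (LocalRing L v)) 0 2) w) ≤ Valued.v ϖ ^ 0 ∧ Valued.v (((((m : ↥(unitaryGroupOfForm (conjLocal L (IsCMField.complexConj L) v) (cmLocalForm L 3 v))) : GL (Fin 3) (LocalRing L v)) : Matrix (Fin 3) (Fin 3) (LocalRing L v)) 0 1) w) ≤ Valued.v ϖ ^ r₁} =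
        {m : ↥(cmBorelTriple L 3 v).N | Valued.v (((((m : ↥(unitaryGroupOfForm (conjLocal L (IsCMField.complexConj L) v) (cmLocalForm L 3 v))) : GL (Fin 3) (LocalRing L v)) : Matrix (Fin 3) (Fin 3) (LocalRing L v)) 0 1) w) ≤ WithZero.exp (-(r₁ : ℤ)) ∧ Valued.v (((((m : ↥(unitaryGroupOfForm (conjLocal L (IsCMField.complexConj L) v) (cmLocalForm L 3 v))) : GL (Fin 3) (LocalRing L v)) : Matrix (Fin 3) (Fin 3) (LocalRing L v)) 0 2) w) ≤ WithZero.exp (0)} := by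
      ext m; simp only [Set.mem_setOf_eq, hpow, Nat.cast_zero, neg_zero]; exact and_comm
    rw [hset, h, zpow_zero, mul_one, zpow_neg, zpow_natCast, ← pow_mul]
  have hB1 : μ.real {m : ↥(cmBorelTriple L 3 v).N | Valued.v (((((m : ↥(unitaryGroupOfForm (conjLocal L (IsCMField.complexConj L) v) (cmLocalForm L 3 v))) : GL (Fin 3) (LocalRing L v)) : Matrix (Fin 3) (Fin 3) (LocalRing L v)) 0 2) w) ≤ Valued.v ϖ ^ 1 ∧ Valued.v (((((m : ↥(unitaryGroupOfForm (conjLocal L (IsCMField.complexConj L) v) (cmLocalForm L 3 v))) : GL (Fin 3) (LocalRing L v)) : Matrix (Fin 3) (Fin 3) (LocalRing L v)) 0 1) w) ≤ Valued.v ϖ ^ r₂} =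
      ((Ideal.absNorm v.asIdeal : ℝ) ^ (2 * r₂ + 1))⁻¹ * μ.real {m : ↥(cmBorelTriple L 3 v).N | Valued.v (((((m : ↥(unitaryGroupOfForm (conjLocal L (IsCMField.complexConj L) v) (cmLocalForm L 3 v))) : GL (Fin 3) (LocalRing L v)) : Matrix (Fin 3) (Fin 3) (LocalRing L v)) 0 2) w) ≤ 1} := by
    have h := BposBoxVolumesTwoDepth.measureReal_box_eq L v w hw hunr μ (-(r₂ : ℤ)) (-1) (by omega) (Or.inr rfl)
    have hset : {m : ↥(cmBorelTriple L 3 v).N | Valued.v (((((m : ↥(unitaryGroupOfForm (conjLocal L (IsCMField.complexConj L) v) (cmLocalForm L 3 v))) : GL (Fin 3) (LocalRing L v)) : Matrix (Fin 3) (Fin 3) (LocalRing L v)) 0 2) w) ≤ Valued.v ϖ ^ 1 ∧ Valued.v (((((m : ↥(unitaryGroupOfForm (conjLocal L (IsCMField.complexConj L) v) (cmLocalForm L 3 v))) : GL (Fin 3) (LocalRing L v)) : Matrix (Fin 3) (Fin 3) (LocalRing L v)) 0 1) w) ≤ Valued.v ϖ ^ r₂} =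
        {m : ↥(cmBorelTriple L 3 v).N | Valued.v (((((m : ↥(unitaryGroupOfForm (conjLocal L (IsCMField.complexConj L) v) (cmLocalForm L 3 v))) : GL (Fin 3) (LocalRing L v)) : Matrix (Fin 3) (Fin 3) (LocalRing L v)) 0 1) w) ≤ WithZero.exp (-(r₂ : ℤ)) ∧ Valued.v (((((m : ↥(unitaryGroupOfForm (conjLocal L (IsCMField.complexConj L) v) (cmLocalForm L 3 v))) : GL (Fin 3) (LocalRing L v)) : Matrix (Fin 3) (Fin 3) (LocalRing L v)) 0 2) w) ≤ WithZero.exp (-1)} := by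
      ext m; simp only [Set.mem_setOf_eq, hpow, Nat.cast_one]; exact and_comm
    rw [hset, h, zpow_neg, zpow_natCast, ← pow_mul, zpow_neg, zpow_one, ← mul_inv, ← pow_succ]
  refine ⟨((μ.real {m : ↥(cmBorelTriple L 3 v).N | Valued.v (((((m : ↥(unitaryGroupOfForm (conjLocal L (IsCMField.complexConj L) v) (cmLocalForm L 3 v))) : GL (Fin 3) (LocalRing L v)) : Matrix (Fin 3) (Fin 3) (LocalRing L v)) 0 2) w) ≤ 1} : ℝ) : ℂ), ((χ₁ δ₀ : ℂˣ) : ℂ), (-1) ^ m, hV, hε, by rw [← pow_mul, mul_comm, pow_mul, neg_one_sq, one_pow], ?_, ?_, ?_, ?_, ?_, ?_, ?_, ?_⟩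
  · -- `hi₁₁`
    rw [hf11]; exact (integrable_indicator_iff hSc1).2 hint1
  · -- `hiw₁`
    rw [hfw1]; exact (integrable_indicator_iff hSb0).2 (integrableOn_const hfin0.ne)
  · -- `hi₁₂`
    rw [hf1w]; exact (integrable_indicator_iff hSb1).2 (integrableOn_const hfin1.ne)
  · -- `hiw₂`
    rw [hfww]; exact (integrable_indicator_iff hSc0).2 hint0
  · -- `h11v` = MASTER(r₂, 1)
    rw [show (∫ n : ↥(cmBorelTriple L 3 v).N, f₁.toFun (w₀ * (n : ↥(unitaryGroupOfForm (conjLocal L (IsCMField.complexConj L) v) (cmLocalForm L 3 v))) * 1) ∂μ) =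
        ∫ n : ↥(cmBorelTriple L 3 v).N, Set.indicator {n : ↥(cmBorelTriple L 3 v).N | WithZero.exp (1 : ℤ) ≤ Valued.v (((((n : ↥(unitaryGroupOfForm (conjLocal L (IsCMField.complexConj L) v) (cmLocalForm L 3 v))) : GL (Fin 3) (LocalRing L v)) : Matrix (Fin 3) (Fin 3) (LocalRing L v)) 0 2) w) ∧ Valued.v (((((n : ↥(unitaryGroupOfForm (conjLocal L (IsCMField.complexConj L) v) (cmLocalForm L 3 v))) : GL (Fin 3) (LocalRing L v)) : Matrix (Fin 3) (Fin 3) (LocalRing L v)) 0 1) w) ≤ Valued.v ϖ ^ r₂ * Valued.v (((((n : ↥(unitaryGroupOfForm (conjLocal L (IsCMField.complexConj L) v) (cmLocalForm L 3 v))) : GL (Fin 3) (LocalRing L v)) : Matrix (Fin 3) (Fin 3) (LocalRing L v)) 0 2) w)}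
          (fun n : ↥(cmBorelTriple L 3 v).N =>
        if h : IsUnit ((((n : ↥(unitaryGroupOfForm (conjLocal L (IsCMField.complexConj L) v) (cmLocalForm L 3 v))) : GL (Fin 3) (LocalRing L v)) : Matrix (Fin 3) (Fin 3) (LocalRing L v)) 0 2) then
          ((((χ₁ (Units.map ((conjLocal L (IsCMField.complexConj L) v) : LocalRing L v →* LocalRing L v) h.unit))⁻¹ : ℂˣ) : ℂ) *
            ((((unitModulusChar (LocalRing L v) h.unit)⁻¹ : ℝ≥0) : ℝ) : ℂ))
        else 0) n ∂μ from congrArg (fun F => ∫ n, F n ∂μ) hf11, integral_indicator hSc1, hM1]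
    ring
  · -- `hwwv` = MASTER(r₁, 0)
    rw [show (∫ n : ↥(cmBorelTriple L 3 v).N, f_w.toFun (w₀ * (n : ↥(unitaryGroupOfForm (conjLocal L (IsCMField.complexConj L) v) (cmLocalForm L 3 v))) * w₀) ∂μ) =
        ∫ n : ↥(cmBorelTriple L 3 v).N, Set.indicator {n : ↥(cmBorelTriple L 3 v).N | WithZero.exp (0 : ℤ) ≤ Valued.v (((((n : ↥(unitaryGroupOfForm (conjLocal L (IsCMField.complexConj L) v) (cmLocalForm L 3 v))) : GL (Fin 3) (LocalRing L v)) : Matrix (Fin 3) (Fin 3) (LocalRing L v)) 0 2) w) ∧ Valued.v (((((n : ↥(unitaryGroupOfForm (conjLocal L (IsCMField.complexConj L) v) (cmLocalForm L 3 v))) : GL (Fin 3) (LocalRing L v)) : Matrix (Fin 3) (Fin 3) (LocalRing L v)) 0 1) w) ≤ Valued.v ϖ ^ r₁ * Valued.v (((((n : ↥(unitaryGroupOfForm (conjLocal L (IsCMField.complexConj L) v) (cmLocalForm L 3 v))) : GL (Fin 3) (LocalRing L v)) : Matrix (Fin 3) (Fin 3) (LocalRing L v)) 0 2) w)}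
          (fun n : ↥(cmBorelTriple L 3 v).N =>
        if h : IsUnit ((((n : ↥(unitaryGroupOfForm (conjLocal L (IsCMField.complexConj L) v) (cmLocalForm L 3 v))) : GL (Fin 3) (LocalRing L v)) : Matrix (Fin 3) (Fin 3) (LocalRing L v)) 0 2) then
          ((((χ₁ (Units.map ((conjLocal L (IsCMField.complexConj L) v) : LocalRing L v →* LocalRing L v) h.unit))⁻¹ : ℂˣ) : ℂ) *
            ((((unitModulusChar (LocalRing L v) h.unit)⁻¹ : ℝ≥0) : ℝ) : ℂ))
        else 0) n ∂μ from congrArg (fun F => ∫ n, F n ∂μ) hfww, integral_indicator hSc0, hM0]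
    ring
  · -- `hw1v` = box volume `(r₁, 0)`
    rw [show (∫ n : ↥(cmBorelTriple L 3 v).N, f_w.toFun (w₀ * (n : ↥(unitaryGroupOfForm (conjLocal L (IsCMField.complexConj L) v) (cmLocalForm L 3 v))) * 1) ∂μ) =
        ∫ n : ↥(cmBorelTriple L 3 v).N, Set.indicator {m : ↥(cmBorelTriple L 3 v).N | Valued.v (((((m : ↥(unitaryGroupOfForm (conjLocal L (IsCMField.complexConj L) v) (cmLocalForm L 3 v))) : GL (Fin 3) (LocalRing L v)) : Matrix (Fin 3) (Fin 3) (LocalRing L v)) 0 2) w) ≤ Valued.v ϖ ^ 0 ∧ Valued.v (((((m : ↥(unitaryGroupOfForm (conjLocal L (IsCMField.complexConj L) v) (cmLocalForm L 3 v))) : GL (Fin 3) (LocalRing L v)) : Matrix (Fin 3) (Fin 3) (LocalRing L v)) 0 1) w) ≤ Valued.v ϖ ^ r₁} (fun _ => (1 : ℂ)) n ∂μ from congrArg (fun F => ∫ n, F n ∂μ) hfw1,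
      integral_indicator_const _ hSb0, hB0, Complex.real_smul, mul_one]
    push_cast
    ring
  · -- `h1wv` = box volume `(r₂, 1)`
    rw [show (∫ n : ↥(cmBorelTriple L 3 v).N, f₁.toFun (w₀ * (n : ↥(unitaryGroupOfForm (conjLocal L (IsCMField.complexConj L) v) (cmLocalForm L 3 v))) * w₀) ∂μ) =
        ∫ n : ↥(cmBorelTriple L 3 v).N, Set.indicator {m : ↥(cmBorelTriple L 3 v).N | Valued.v (((((m : ↥(unitaryGroupOfForm (conjLocal L (IsCMField.complexConj L) v) (cmLocalForm L 3 v))) : GL (Fin 3) (LocalRing L v)) : Matrix (Fin 3) (Fin 3) (LocalRing L v)) 0 2) w) ≤ Valued.v ϖ ^ 1 ∧ Valued.v (((((m : ↥(unitaryGroupOfForm (conjLocal L (IsCMField.complexConj L) v) (cmLocalForm L 3 v))) : GL (Fin 3) (LocalRing L v)) : Matrix (Fin 3) (Fin 3) (LocalRing L v)) 0 1) w) ≤ Valued.v ϖ ^ r₂} (fun _ => (1 : ℂ)) n ∂μ from congrArg (fun F => ∫ n, F n ∂μ) hf1w,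
      integral_indicator_const _ hSb1, hB1, Complex.real_smul, mul_one]
    push_cast
    ring

end Summit.HodgeConjecture.HodgeConjecture.R90.S1.BposPairEntriesOfMaster

end
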